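import Summits.ABC.ABC.Theorems.IsogenyGlueCongruenceEllipticGluingPrimeBoundStubBigImageTorsionCoreAux5
import Literature.NumberTheory.EllipticCurves.KummerSelmerStructure
import Literature.NumberTheory.EllipticCurves.GaloisAction
import Literature.NumberTheory.GaloisRepresentations.AbsGaloisGroup
import HarnessLib

/-!
# Crux `EllipticGluingPrimeBound`, line SketchIdeator5 — stub `stub_endFieldDichotomy`
# (the endomorphism-field DICHOTOMY for torsion-sharing partners, arithmetic shell)

Stub `stub_endFieldDichotomy` of line `SketchIdeator5` (slices of the free branch `U_simple`) of
crux U `Summit.ABC.ABC.Theses.IsogenyGlueCongruence.EllipticGluingPrimeBound` (item stmt-ABC-13919),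
registered signature (namespace `Summit.ABC.ABC.Theorems.GluingSlices`).

**Statement.** Assume the algebraic dichotomy core (the registered neighbour
`stub_imageDichotomyCore`, taken as a hypothesis).  Let `W/ℚ` be an elliptic curve whose mod-`ℓ`
representation is surjective, `ℓ ≥ 5`, and let `A/ℚ` be ANY abelian variety, with
`Γ_A = {σ ∈ Γ_ℚ | σ fixes every geometric endomorphism of A} = Gal(ℚ̄/L_A)`.  Then EITHER
`ℓ ≤ 4 (dim A)² + 1`, OR `Γ_A` still realises every element of the commutator subgroup
(`= SL₂(𝔽_ℓ)`) of `Aut W[ℓ]`: beyond `4 (dim A)² + 1` a congruence `W[ℓ] ↪ A` is already "full"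
over the endomorphism field of the partner.  No hypothesis on `A`; the partner's height, conductor
and `[L_A : ℚ]` never enter.

**Proof.** As for the abelian slice (`stub_endFieldAbelianPartnerBound`, p125034): instantiate the
core with `Γ = Γ_ℚ` acting on the lattice `End(A_ℚ̄)` by `galConj` (finite image:
`AbelianVariety.finite_range_toRingHom_galois`; rank `≤ 4 dim A · dim A`:
`BigImage.homGaloisLattice`) and with `π = ρ̄_{W,ℓ}` onto `Aut W[ℓ]` (`#W[ℓ] = ℓ²`:
`WeierstrassCurve.natCard_geomTorsion`); an element of `ker ρ` fixes every geometric
endomorphism.  Consequences: the abelian slice (an abelian `Γ_A`-action cannot contain `SL₂(𝔽_ℓ)`)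
and the reshaped residual of the line (partners with FULL `Γ_A`-image on `W[ℓ]`).  No named facts;
no definitions.
-/

noncomputable section

-- `Summit.<Summit>.<Problem>` is the mandated summit-side namespace (CONVENTIONS §2); for the
-- single-conjunct summit `ABC` the two coincide, so the duplicate `ABC.ABC` is deliberate.
set_option linter.dupNamespace false

namespace Summit.ABC.ABC.Theorems.GluingSlices

open CategoryTheory CategoryTheory.Limits AlgebraicGeometry
open Literature.AlgebraicGeometry.Motives
open Summit.ABC.ABC.Theorems.IsotypicMinkowski

/-- **Registered stub `stub_endFieldDichotomy`** (endomorphism-field dichotomy, arithmetic shell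
over the algebraic core): for `W/ℚ` with surjective `ρ̄_{W,ℓ}`, `ℓ ≥ 5`, and any abelian variety
`A/ℚ`, either `ℓ ≤ 4 (dim A)² + 1` or every commutator automorphism of `W[ℓ]` is `ρ̄_{W,ℓ}(σ)`
for some `σ ∈ Γ_ℚ` fixing all geometric endomorphisms of `A`. -/
theorem stub_endFieldDichotomy :
    (∀ (ℓ : ℕ) [Fact ℓ.Prime], 5 ≤ ℓ →
      ∀ {Γ H V : Type} [Group Γ] [AddCommGroup H] [Module.Free ℤ H] [Module.Finite ℤ H]
        [AddCommGroup V], Nat.card V = ℓ ^ 2 → (∀ v : V, (ℓ : ℤ) • v = 0) →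
        ∀ (ρ : Representation ℤ Γ H), (Set.range ρ).Finite →
        ∀ (π : Γ →* Multiplicative (AddAut V)), Function.Surjective π →
          ℓ ≤ Module.finrank ℤ H + 1 ∨
          commutator (Multiplicative (AddAut V)) ≤ (ρ.asGroupHom.ker).map π) →
    ∀ (W : WeierstrassCurve ℚ) [W.IsElliptic] (A : AbelianVariety.{0} ℚ) (ℓ : ℕ), ℓ.Prime → 5 ≤ ℓ →
      W.HasSurjectiveModNGaloisRep ℓ →
      ℓ ≤ 4 * A.dim ^ 2 + 1 ∨
      ∀ g ∈ commutator (Multiplicative (AddAut (W.geomTorsion ℓ))),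
        ∃ σ : Field.absoluteGaloisGroup ℚ,
          (∀ r : A.baseChange (AlgebraicClosure ℚ) ⟶ A.baseChange (AlgebraicClosure ℚ),
            A.galConj (AlgebraicClosure ℚ) (Field.absoluteGaloisGroup.toAlgEquiv ℚ σ) r = r) ∧
          W.galoisRepTorsion ℓ σ = g := by
  intro hcore W _ A ℓ hℓ h5 hsurj
  haveI : Fact ℓ.Prime := ⟨hℓ⟩
  -- the lattice `End(A_ℚ̄)`: free of finite rank `≤ 4 dim A · dim A`
  obtain ⟨hfree, hfinite, hrank, -⟩ := BigImage.homGaloisLattice A A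
  haveI := hfree
  haveI := hfinite
  -- the Galois representation on `End(A_ℚ̄)` by `galConj`
  let θ (σ : Field.absoluteGaloisGroup ℚ) :
      (A.baseChange (AlgebraicClosure ℚ) ⟶ A.baseChange (AlgebraicClosure ℚ)) →ₗ[ℤ]
        (A.baseChange (AlgebraicClosure ℚ) ⟶ A.baseChange (AlgebraicClosure ℚ)) :=
    (AddMonoidHom.mk'
      (fun r ↦ A.galConj (AlgebraicClosure ℚ) (Field.absoluteGaloisGroup.toAlgEquiv ℚ σ) r)
      (A.galConj_add (AlgebraicClosure ℚ) (Field.absoluteGaloisGroup.toAlgEquiv ℚ σ))).toIntLinearMap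
  have θ_apply : ∀ σ r, θ σ r =
      A.galConj (AlgebraicClosure ℚ) (Field.absoluteGaloisGroup.toAlgEquiv ℚ σ) r := fun _ _ ↦ rfl
  let ρ : Representation ℤ (Field.absoluteGaloisGroup ℚ)
      (A.baseChange (AlgebraicClosure ℚ) ⟶ A.baseChange (AlgebraicClosure ℚ)) :=
    { toFun := θ
      map_one' := by
        refine LinearMap.ext fun r ↦ ?_
        rw [θ_apply, map_one]
        exact A.galConj_one (AlgebraicClosure ℚ) r
      map_mul' := fun σ τ ↦ by
        refine LinearMap.ext fun r ↦ ?_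
        rw [θ_apply, map_mul]
        exact A.galConj_mul (AlgebraicClosure ℚ) _ _ r }
  have ρ_apply : ∀ σ r, ρ σ r =
      A.galConj (AlgebraicClosure ℚ) (Field.absoluteGaloisGroup.toAlgEquiv ℚ σ) r := fun _ _ ↦ rfl
  -- finite image: `ρ σ` only depends on the ring automorphism `σ • ·` of `End(A_ℚ̄)`
  have hfin : (Set.range ρ).Finite := by
    have hfin₀ := A.finite_range_toRingHom_galois (AbelianVariety.module_finite_hom_holds _ _)
      AbelianVariety.isTorsionFree_int_hom_of_charZero
    let Ψ : (End (A.baseChange (AlgebraicClosure ℚ)) →+* End (A.baseChange (AlgebraicClosure ℚ))) →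
        ((A.baseChange (AlgebraicClosure ℚ) ⟶ A.baseChange (AlgebraicClosure ℚ)) →ₗ[ℤ]
          (A.baseChange (AlgebraicClosure ℚ) ⟶ A.baseChange (AlgebraicClosure ℚ))) := fun t ↦
      (AddMonoidHom.mk' (fun f ↦ End.asHom (t (End.of f))) (fun f g ↦ by
        change t (End.of f + End.of g) = t (End.of f) + t (End.of g)
        rw [t.map_add])).toIntLinearMap
    refine (hfin₀.image Ψ).subset ?_
    rintro _ ⟨σ, rfl⟩
    refine ⟨MulSemiringAction.toRingHom (AlgebraicClosure ℚ ≃ₐ[ℚ] AlgebraicClosure ℚ)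
        (End (A.baseChange (AlgebraicClosure ℚ))) (Field.absoluteGaloisGroup.toAlgEquiv ℚ σ),
      ⟨Field.absoluteGaloisGroup.toAlgEquiv ℚ σ, rfl⟩, ?_⟩
    refine LinearMap.ext fun f ↦ ?_
    rfl
  -- `V = W[ℓ]`: `#W[ℓ] = ℓ²`, `ℓ W[ℓ] = 0`
  have hcard : Nat.card (W.geomTorsion ℓ) = ℓ ^ 2 := by
    rw [W.natCard_geomTorsion (ℓ : ℤ) (by exact_mod_cast hℓ.ne_zero), Int.natAbs_natCast]
  have htor : ∀ v : W.geomTorsion ℓ, (ℓ : ℤ) • v = 0 := fun v ↦ by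
    rw [natCast_zsmul]
    exact AddSubgroup.torsionBy.nsmul v
  -- the core dichotomy
  rcases hcore ℓ h5 hcard htor ρ hfin (W.galoisRepTorsion ℓ) hsurj with hle | hfull
  · left
    have hsq : A.dim ^ 2 = A.dim * A.dim := sq A.dim
    rw [hsq]
    calc ℓ ≤ Module.finrank ℤ (A.baseChange (AlgebraicClosure ℚ) ⟶ A.baseChange (AlgebraicClosure ℚ))
          + 1 := hle
      _ ≤ 4 * A.dim * A.dim + 1 := by omega
      _ = 4 * (A.dim * A.dim) + 1 := by ring
  · right
    intro g hg
    obtain ⟨σ, hσK, hσg⟩ := Subgroup.mem_map.mp (hfull hg)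
    refine ⟨σ, fun r ↦ ?_, hσg⟩
    have hσ1 : ρ σ = 1 := by
      rw [← Representation.asGroupHom_apply, MonoidHom.mem_ker.mp hσK, Units.val_one]
    rw [← ρ_apply, hσ1]
    rfl

end Summit.ABC.ABC.Theorems.GluingSlices

end
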